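import Literature.NumberTheory.NumberFields.CyclicQuinticField2651K4Places
import Literature.NumberTheory.NumberFields.QuinticCertSound
import Literature.NumberTheory.NumberFields.CyclicQuinticField2651K4ClassData1
import Literature.NumberTheory.NumberFields.CyclicQuinticField2651K4ClassData2
import Literature.NumberTheory.NumberFields.CyclicQuinticField2651K4ClassData3
import Literature.NumberTheory.NumberFields.CyclicQuinticField2651K4ClassData4
import Literature.NumberTheory.NumberFields.CyclicQuinticField2651K4ClassData5
import Literature.NumberTheory.NumberFields.CyclicQuinticField2651K4ClassData6
import Literature.NumberTheory.NumberFields.CyclicQuinticField2651K4ClassData7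
import Literature.NumberTheory.NumberFields.CyclicQuinticField2651K4ClassData8
import Literature.NumberTheory.NumberFields.CyclicQuinticField2651K4ClassData9
import Literature.NumberTheory.NumberFields.CyclicQuinticField2651K4ClassData10
import Literature.NumberTheory.NumberFields.CyclicQuinticField2651K4ClassData11
import Mathlib.NumberTheory.NumberField.Norm
import HarnessLib

/-!
# The cyclic quintic field of conductor `2651`, number `4`: the class group has no `2`-torsion

For `K = CyclicQuintic2651K4.K` (`h_K = 25` or `125` numerically — NOT computed here) we prove
**`∀ I ≠ 0, I² principal → I principal`** (`isPrincipal_of_sq_isPrincipal`), by instantiating the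
generic soundness theorem `QuinticCert.Reads.isPrincipal_of_sq_isPrincipal` of the kernel-checked
fifth-power certificate (`CyclicQuinticField2651K4ClassData*.lean`: for every prime `p ≤ 269867`,
`p ∉ {11, 241}`, either an element `β` with `(β) = P⁵ · P₁₁ᵃ P₂₄₁ᵇ` for the primes `P` above `p`, or
a certificate that `f̄` has no root / is irreducible modulo `p`), the Minkowski bound
`⌊M_K⌋ ≤ 269867` (`…Places.lean`), the ring of integers `𝓞 K = ⊕ ℤ g_b` (`…Integers.lean`) and the
totally ramified primes above `11` and `241` (`ε = g₀ - 9`, `g₀ - 193`). Everything is PROVED.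

## References

* H. Cohen, *A Course in Computational Algebraic Number Theory*, GTM 138 (1993), §6.5. [folklore]
* T. Dokchitser, V. Dokchitser, J. Number Theory 131 (2011) 1833–1839, proof of Thm. 2. [DokchitserDokchitser2011RankModN]
-/

noncomputable section

open NumberField Ideal

namespace Literature.NumberTheory.NumberFields

namespace CyclicQuintic2651K4

open QuinticCert

/-! ### The checker reads the table of `K` -/

/-- The checker's constants read `spec`. [folklore] -/
theorem reads : QuinticCert.Reads CK4 spec where
  one_eq _ := rfl
  tab_coef := by decide +kernel

/-- The inverse shift is a symmetry of the table. [folklore] -/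
theorem isSymmetry_shiftInv : spec.IsSymmetry (Equiv.addRight (4 : Fin 5)) := by
  decide +kernel

/-! ### The raw multiplication and norm versus the order -/

/-- Raw `Int.add`/`Int.mul` are `+`/`*`. [folklore] -/
theorem rawIntAdd (a b : ℤ) : Int.add a b = a + b := rfl
/-- Raw `Int.mul` is `*`. [folklore] -/
theorem rawIntMul (a b : ℤ) : Int.mul a b = a * b := rfl

/-- **The raw multiplication is the multiplication of the order.** [folklore] -/
theorem toT_mul (u v : Z5) : toT spec (mulK4 u v) = toT spec u * toT spec v := by
  ext d
  rw [TAlg.mul_coef]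
  fin_cases d <;>
  · simp only [toT_coef, Z5.toFin, mulK4, spec, Fin.sum_univ_five, Fin.isValue,
      Matrix.cons_val_zero, Matrix.cons_val_one, Matrix.head_cons, Matrix.cons_val_two, Matrix.tail_cons,
      Matrix.cons_val_three, Matrix.cons_val_four, rawIntAdd, rawIntMul, Int.ofNat_eq_natCast,
      Int.negSucc_eq, Nat.cast_ofNat, Fin.zero_eta, Fin.mk_one, Fin.reduceFinMk, Int.cast_id]
    push_cast
    ring

/-- The raw shift is the shift of the order. [folklore] -/
theorem toT_shift (u : Z5) : toT spec (Z5.shift u) = shift (toT spec u) := by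
  ext d
  fin_cases d <;> rfl

/-- `isConst`: the element is the constant `n`. [folklore] -/
theorem toT_eq_intCast_of_isConst {u : Z5} {n : ℤ} (h : Z5.isConst u n = true) : toT spec u = (n : R) := by
  unfold Z5.isConst at h
  simp only [Bool.and_eq_true, ibeq_eq_true_iff] at h
  obtain ⟨⟨⟨⟨h0, h1⟩, h2⟩, h3⟩, h4⟩ := h
  ext d
  fin_cases d <;> simp [Z5.toFin, h0, h1, h2, h3, h4, spec]

/-- **The raw norm is the norm form of the order.** [folklore] -/
theorem toT_norm (u : Z5) : toT spec (Z5.norm mulK4 u) = normT (toT spec u) := by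
  simp only [Z5.norm, toT_mul, toT_shift, normT]

/-- **Norm hypothesis**: an accepted raw norm is the norm of the algebraic integer. [folklore] -/
theorem hnorm (u : Z5) (n : ℤ) (h : (Z5.norm mulK4 u).isConst n = true) :
    Algebra.norm ℤ (integerEquiv (toT spec u)) = n := by
  have h1 : normT (toT spec u) = (n : R) := by rw [← toT_norm, toT_eq_intCast_of_isConst h]
  have h2 := norm_liftK_of_normT_eq h1
  have h3 : (Algebra.norm ℤ (integerEquiv (toT spec u)) : ℚ) = n := by
    rw [Algebra.coe_norm_int, coe_integerEquiv, h2]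
  exact_mod_cast h3

/-- The inverse shift of the order is `σ⁴` in the field. [folklore] -/
theorem liftK_shiftInv (y : R) : liftK (shiftInv isSymmetry_shiftInv y) = (σ ^ 4) (liftK y) := by
  have h : liftK.comp (shiftInv isSymmetry_shiftInv) = ((σ ^ 4).toRingEquiv.toRingHom).comp liftK :=
    TableSpec.ringHom_ext fun b => by
      change liftK (shiftInv isSymmetry_shiftInv (TAlg.basis b)) = (σ ^ 4) (liftK (TAlg.basis b))
      rw [shiftInv, TAlg.perm_basis, liftK_basis, liftK_basis, Equiv.coe_addRight, σ_pow_apply]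
      simp only [Function.iterate_succ_apply', Function.iterate_zero_apply, σ_g]
      congr 1
      abel
  exact RingHom.congr_fun h y

/-- **Norm hypothesis for the shift**: the norm is `σ`-invariant. [folklore] -/
theorem hnormShift (u : R) :
    Algebra.norm ℤ (integerEquiv (shiftInv isSymmetry_shiftInv u)) = Algebra.norm ℤ (integerEquiv u) := by
  have h : (Algebra.norm ℤ (integerEquiv (shiftInv isSymmetry_shiftInv u)) : ℚ) = Algebra.norm ℤ (integerEquiv u) := by
    rw [Algebra.coe_norm_int, Algebra.coe_norm_int, coe_integerEquiv, coe_integerEquiv, liftK_shiftInv]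
    exact Algebra.norm_eq_of_algEquiv (σ ^ 4) (liftK u)
  exact_mod_cast h

/-! ### The totally ramified primes `11` and `241` -/

/-- The constant vector `(9, …, 9)` is a homomorphism modulo `11`. [folklore] -/
theorem isHom_eleven : CK4.isHom 11 ⟨9, 9, 9, 9, 9⟩ = true := by decide +kernel

/-- The constant vector `(193, …, 193)` is a homomorphism modulo `241`. [folklore] -/
theorem isHom_241 : CK4.isHom 241 ⟨193, 193, 193, 193, 193⟩ = true := by decide +kernel

/-- `(g₀ - 9)⁵ = 11 · w₁₁`. [folklore] -/
theorem eps11_pow_five : (TAlg.basis 0 - (9 : R)) ^ 5 = (11 : R) * (⟨![-4540774, -5080209, -5024208, -4964004, -4936254]⟩ : R) := by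
  decide +kernel

/-- `(g₀ - 193)⁵ = 241 · w₂₄₁`. [folklore] -/
theorem eps241_pow_five : (TAlg.basis 0 - (193 : R)) ^ 5 = (241 : R) * (⟨![-1219780458, -1260767923, -1259066272, -1257068548, -1255844338]⟩ : R) := by
  decide +kernel

/-- `red 11 eps11 = g₀ - 9`. [folklore] -/
theorem red_eps11_eq : red 11 eps11 = TAlg.basis 0 - (9 : TAlg spec (ZMod 11)) := by decide +kernel

/-- `red 241 eps241 = g₀ - 193`. [folklore] -/
theorem red_eps241_eq : red 241 eps241 = TAlg.basis 0 - (193 : TAlg spec (ZMod 241)) := by decide +kernel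

/-- **The prime above `11`** (`P₁₁⁵ = (11)`, unique). [folklore] -/
def ram11 : RamPrime K 11 :=
  reads.ramPrime integerEquiv finrank_K (q := 11) (c := 9) (by norm_num) isHom_eleven _
    (by exact_mod_cast eps11_pow_five) B11
    (fun b => by rw [show ((9 : ℕ) : TAlg spec (ZMod 11)) = (9 : TAlg spec (ZMod 11)) by norm_cast, ← red_eps11_eq]; exact basis_eq_sum_pow_eps11 b)

/-- **The prime above `241`** (`P₂₄₁⁵ = (241)`, unique). [folklore] -/
def ram241 : RamPrime K 241 :=
  reads.ramPrime integerEquiv finrank_K (q := 241) (c := 193) (by norm_num) isHom_241 _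
    (by exact_mod_cast eps241_pow_five) B241
    (fun b => by rw [show ((193 : ℕ) : TAlg spec (ZMod 241)) = (193 : TAlg spec (ZMod 241)) by norm_cast, ← red_eps241_eq]; exact basis_eq_sum_pow_eps241 b)

/-! ### The relation of `g₀` and the index -/

/-- **`f(g₀) = 0` in the order.** [folklore] -/
theorem hf0 : (TAlg.basis 0 : R) ^ 5 + (CK4.f.a4 : R) * TAlg.basis 0 ^ 4 + (CK4.f.a3 : R) * TAlg.basis 0 ^ 3 +
    (CK4.f.a2 : R) * TAlg.basis 0 ^ 2 + (CK4.f.a1 : R) * TAlg.basis 0 + (CK4.f.a0 : R) = 0 := by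
  decide +kernel

/-- The coefficient vectors of `D · g_b` on the powers of `g₀`. [folklore] -/
def cDex : Fin 5 → Fin 5 → ℤ := ![![0, 61827, 0, 0, 0], ![-7696986, 2123762, -143679, 328, 138], ![9914418, -3701438, 293302, -1270, -283], ![-2445096, 1567709, -179002, 1945, 190], ![289491, -51860, 29379, -1003, -45]]

/-- **`D · g_b = P_b(g₀)` in the order.** [folklore] -/
theorem hDex_eq : ∀ b : Fin 5, (CK4.D : R) * TAlg.basis b = ∑ k : Fin 5, (cDex b k : R) * TAlg.basis 0 ^ (k : ℕ) := by
  decide +kernel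

/-- The index hypothesis. [folklore] -/
theorem hDex : ∀ b : Fin 5, ∃ c : Fin 5 → ℤ, (CK4.D : R) * TAlg.basis b = ∑ k : Fin 5, (c k : R) * TAlg.basis 0 ^ (k : ℕ) :=
  fun b => ⟨cDex b, hDex_eq b⟩


/-- The inert certificates of `2` (no root; irreducible). [folklore] -/
theorem inertCert_two : CK4.f.noRootCert 2 ⟨1, 0, 0, 1, 0⟩ = true ∧ CK4.f.irredCert 2 ⟨1, 1, 0, 0, 0⟩ = true := by
  constructor <;> decide +kernel

/-- **`(2)` is inert**: every prime ideal containing `2` is `(2)`, which is maximal. [folklore] -/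
theorem span_two : (Ideal.span {(2 : 𝓞 K)}).IsMaximal ∧
    ∀ Q : Ideal (𝓞 K), Q.IsPrime → ((2 : ℕ) : 𝓞 K) ∈ Q → Q = Ideal.span {((2 : ℕ) : 𝓞 K)} := by
  have key : ∀ Q : Ideal (𝓞 K), Q.IsPrime → ((2 : ℕ) : 𝓞 K) ∈ Q → Q = Ideal.span {((2 : ℕ) : 𝓞 K)} :=
    fun Q hQ hm => by
      haveI := hQ
      exact eq_span_of_inert_small reads integerEquiv hf0 (by norm_num) (by norm_num)
        (by decide : ¬ (2 : ℕ) ∣ CK4.D) hDex inertCert_two.2 hm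
  refine ⟨?_, key⟩
  -- a maximal ideal above `2` exists and equals `(2)`
  have hne : Ideal.span {((2 : ℕ) : 𝓞 K)} ≠ ⊤ := by
    rw [Ne, Ideal.span_singleton_eq_top]
    intro hu
    have h1 : IsUnit (Algebra.norm ℤ (((2 : ℕ) : 𝓞 K))) := hu.map _
    rw [show (((2 : ℕ) : 𝓞 K)) = algebraMap ℤ (𝓞 K) (2 : ℤ) by simp, Algebra.norm_algebraMap,
      RingOfIntegers.rank, finrank_K, Int.isUnit_iff] at h1
    norm_num at h1
  obtain ⟨Q, hQmax, hle⟩ := Ideal.exists_le_maximal _ hne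
  have := key Q hQmax.isPrime ((Ideal.span_singleton_le_iff_mem _).mp hle)
  rw [show ((2 : 𝓞 K)) = (((2 : ℕ)) : 𝓞 K) by norm_cast, ← this]; exact hQmax

/-- The inert certificates of `5` (no root; irreducible). [folklore] -/
theorem inertCert_five : CK4.f.noRootCert 5 ⟨4, 3, 1, 4, 1⟩ = true ∧ CK4.f.irredCert 5 ⟨2, 4, 2, 2, 1⟩ = true := by
  constructor <;> decide +kernel

/-- **`(5)` is inert**: every prime ideal containing `5` is `(5)`, which is maximal. [folklore] -/
theorem span_five : (Ideal.span {(5 : 𝓞 K)}).IsMaximal ∧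
    ∀ Q : Ideal (𝓞 K), Q.IsPrime → ((5 : ℕ) : 𝓞 K) ∈ Q → Q = Ideal.span {((5 : ℕ) : 𝓞 K)} := by
  have key : ∀ Q : Ideal (𝓞 K), Q.IsPrime → ((5 : ℕ) : 𝓞 K) ∈ Q → Q = Ideal.span {((5 : ℕ) : 𝓞 K)} :=
    fun Q hQ hm => by
      haveI := hQ
      exact eq_span_of_inert_small reads integerEquiv hf0 (by norm_num) (by norm_num)
        (by decide : ¬ (5 : ℕ) ∣ CK4.D) hDex inertCert_five.2 hm
  refine ⟨?_, key⟩
  -- a maximal ideal above `5` exists and equals `(5)`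
  have hne : Ideal.span {((5 : ℕ) : 𝓞 K)} ≠ ⊤ := by
    rw [Ne, Ideal.span_singleton_eq_top]
    intro hu
    have h1 : IsUnit (Algebra.norm ℤ (((5 : ℕ) : 𝓞 K))) := hu.map _
    rw [show (((5 : ℕ) : 𝓞 K)) = algebraMap ℤ (𝓞 K) (5 : ℤ) by simp, Algebra.norm_algebraMap,
      RingOfIntegers.rank, finrank_K, Int.isUnit_iff] at h1
    norm_num at h1
  obtain ⟨Q, hQmax, hle⟩ := Ideal.exists_le_maximal _ hne
  have := key Q hQmax.isPrime ((Ideal.span_singleton_le_iff_mem _).mp hle)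
  rw [show ((5 : 𝓞 K)) = (((5 : ℕ)) : 𝓞 K) by norm_cast, ← this]; exact hQmax

/-- **`𝓞 K/2 = R/2R` is a field** (`f̄` irreducible modulo `2`, `g₀` generates). [folklore] -/
theorem isField_mod_two : IsField (TAlg spec (ZMod 2)) := by
  classical
  haveI : Fact (Nat.Prime 2) := ⟨Nat.prime_two⟩
  have hirr := irreducible_of_irredCert CK4.f (by norm_num : 2 < 2 ^ 64) inertCert_two.2
  obtain ⟨e0, e1, e2, e3, e4⟩ := red_P_eq (p := 2) CK4.f
  set rd : R →+* TAlg spec (ZMod 2) := TAlg.map (Int.castRingHom (ZMod 2)) with hrd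
  have hrel : (TAlg.basis 0 : TAlg spec (ZMod 2)) ^ 5 =
      TAlg.const (((CK4.f.red 2).P4 : ℕ) : ZMod 2) * TAlg.basis 0 ^ 4 +
      TAlg.const (((CK4.f.red 2).P3 : ℕ) : ZMod 2) * TAlg.basis 0 ^ 3 +
      TAlg.const (((CK4.f.red 2).P2 : ℕ) : ZMod 2) * TAlg.basis 0 ^ 2 +
      TAlg.const (((CK4.f.red 2).P1 : ℕ) : ZMod 2) * TAlg.basis 0 +
      TAlg.const (((CK4.f.red 2).P0 : ℕ) : ZMod 2) := by
    have h := congrArg rd hf0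
    simp only [map_add, map_mul, map_pow, map_zero, hrd, map_basis, QuinticCert.map_intCast', Int.coe_castRingHom] at h
    rw [e0, e1, e2, e3, e4, map_neg, map_neg, map_neg, map_neg, map_neg]
    linear_combination h
  have hDu : IsUnit ((CK4.D : ℕ) : ZMod 2) := by
    rw [isUnit_iff_ne_zero, Ne, ZMod.natCast_eq_zero_iff]; decide
  choose c hc using hDex
  refine TAlg.isField_of_generator (TAlg.basis 0) _ _ _ _ _ hrel hirr
    (fun b k => ((CK4.D : ℕ) : ZMod 2)⁻¹ * ((c b k : ℤ) : ZMod 2)) (fun b => ?_) ?_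
  · have h := congrArg rd (hc b)
    simp only [map_mul, map_sum, map_pow, hrd, map_basis, QuinticCert.map_intCast', map_natCast, Int.coe_castRingHom] at h
    have hD' : (TAlg.const (((CK4.D : ℕ) : ZMod 2)⁻¹) : TAlg spec (ZMod 2)) * ((CK4.D : ℕ) : TAlg spec (ZMod 2)) = 1 := by
      rw [show ((CK4.D : ℕ) : TAlg spec (ZMod 2)) = TAlg.const ((CK4.D : ℕ) : ZMod 2) by ext a; simp, ← map_mul,
        inv_mul_cancel₀ hDu.ne_zero, map_one]
    calc (TAlg.basis b : TAlg spec (ZMod 2))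
        = TAlg.const (((CK4.D : ℕ) : ZMod 2)⁻¹) * (((CK4.D : ℕ) : TAlg spec (ZMod 2)) * TAlg.basis b) := by
          rw [← mul_assoc, hD', one_mul]
      _ = _ := by
          rw [h, Finset.mul_sum]
          refine Finset.sum_congr rfl fun k _ => ?_
          rw [← mul_assoc, ← map_mul]
  · intro h01
    have := congrArg (fun u : TAlg spec (ZMod 2) => u.coef 0) h01
    simp [spec] at this

/-! ### The certificate data and its coverage -/

/-- The records of the `k`-th range `[2 + 3072k, 2 + 3072(k+1))`. [folklore] -/
def dataOf : ℕ → List Rec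
  | 0 => decBlobs bl0
  | 1 => decBlobs bl1
  | 2 => decBlobs bl2
  | 3 => decBlobs bl3
  | 4 => decBlobs bl4
  | 5 => decBlobs bl5
  | 6 => decBlobs bl6
  | 7 => decBlobs bl7
  | 8 => decBlobs bl8
  | 9 => decBlobs bl9
  | 10 => decBlobs bl10
  | 11 => decBlobs bl11
  | 12 => decBlobs bl12
  | 13 => decBlobs bl13
  | 14 => decBlobs bl14
  | 15 => decBlobs bl15
  | 16 => decBlobs bl16
  | 17 => decBlobs bl17
  | 18 => decBlobs bl18
  | 19 => decBlobs bl19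
  | 20 => decBlobs bl20
  | 21 => decBlobs bl21
  | 22 => decBlobs bl22
  | 23 => decBlobs bl23
  | 24 => decBlobs bl24
  | 25 => decBlobs bl25
  | 26 => decBlobs bl26
  | 27 => decBlobs bl27
  | 28 => decBlobs bl28
  | 29 => decBlobs bl29
  | 30 => decBlobs bl30
  | 31 => decBlobs bl31
  | 32 => decBlobs bl32
  | 33 => decBlobs bl33
  | 34 => decBlobs bl34
  | 35 => decBlobs bl35
  | 36 => decBlobs bl36
  | 37 => decBlobs bl37
  | 38 => decBlobs bl38
  | 39 => decBlobs bl39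
  | 40 => decBlobs bl40
  | 41 => decBlobs bl41
  | 42 => decBlobs bl42
  | 43 => decBlobs bl43
  | 44 => decBlobs bl44
  | 45 => decBlobs bl45
  | 46 => decBlobs bl46
  | 47 => decBlobs bl47
  | 48 => decBlobs bl48
  | 49 => decBlobs bl49
  | 50 => decBlobs bl50
  | 51 => decBlobs bl51
  | 52 => decBlobs bl52
  | 53 => decBlobs bl53
  | 54 => decBlobs bl54
  | 55 => decBlobs bl55
  | 56 => decBlobs bl56
  | 57 => decBlobs bl57
  | 58 => decBlobs bl58
  | 59 => decBlobs bl59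
  | 60 => decBlobs bl60
  | 61 => decBlobs bl61
  | 62 => decBlobs bl62
  | 63 => decBlobs bl63
  | 64 => decBlobs bl64
  | 65 => decBlobs bl65
  | 66 => decBlobs bl66
  | 67 => decBlobs bl67
  | 68 => decBlobs bl68
  | 69 => decBlobs bl69
  | 70 => decBlobs bl70
  | 71 => decBlobs bl71
  | 72 => decBlobs bl72
  | 73 => decBlobs bl73
  | 74 => decBlobs bl74
  | 75 => decBlobs bl75
  | 76 => decBlobs bl76
  | 77 => decBlobs bl77
  | 78 => decBlobs bl78
  | 79 => decBlobs bl79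
  | 80 => decBlobs bl80
  | 81 => decBlobs bl81
  | 82 => decBlobs bl82
  | 83 => decBlobs bl83
  | 84 => decBlobs bl84
  | 85 => decBlobs bl85
  | 86 => decBlobs bl86
  | 87 => decBlobs bl87
  | _ => []

/-- The chunks `(lo, 3, records)` covering `[2, 270338)`. [folklore] -/
def chunks : List (ℕ × ℕ × List Rec) := (List.range 88).map fun k => (2 + 3072 * k, 3, dataOf k)

/-- Coverage of `[2, 269867]`. [folklore] -/
theorem hcover (q : ℕ) (h2 : 2 ≤ q) (hq : q ≤ 269867) : ∃ ch ∈ chunks, ch.1 ≤ q ∧ q < ch.1 + 1024 * ch.2.1 := by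
  refine ⟨(2 + 3072 * ((q - 2) / 3072), 3, dataOf ((q - 2) / 3072)), ?_, ?_, ?_⟩
  · exact List.mem_map.mpr ⟨(q - 2) / 3072, List.mem_range.mpr (by omega), rfl⟩
  · show 2 + 3072 * ((q - 2) / 3072) ≤ q; omega
  · show q < 2 + 3072 * ((q - 2) / 3072) + 1024 * 3; omega

/-- **All chunks are kernel-verified.** [folklore] -/
theorem hcheck : ∀ ch ∈ chunks, CK4.checkRange 269867 (compMask 269867) ch.1 ch.2.1 ch.2.2 = true := by
  intro ch hch
  obtain ⟨k, hk, rfl⟩ := List.mem_map.mp hch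
  rw [List.mem_range] at hk
  interval_cases k
  · exact ok0
  · exact ok1
  · exact ok2
  · exact ok3
  · exact ok4
  · exact ok5
  · exact ok6
  · exact ok7
  · exact ok8
  · exact ok9
  · exact ok10
  · exact ok11
  · exact ok12
  · exact ok13
  · exact ok14
  · exact ok15
  · exact ok16
  · exact ok17
  · exact ok18
  · exact ok19
  · exact ok20
  · exact ok21
  · exact ok22
  · exact ok23
  · exact ok24
  · exact ok25
  · exact ok26
  · exact ok27
  · exact ok28
  · exact ok29
  · exact ok30
  · exact ok31
  · exact ok32
  · exact ok33
  · exact ok34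
  · exact ok35
  · exact ok36
  · exact ok37
  · exact ok38
  · exact ok39
  · exact ok40
  · exact ok41
  · exact ok42
  · exact ok43
  · exact ok44
  · exact ok45
  · exact ok46
  · exact ok47
  · exact ok48
  · exact ok49
  · exact ok50
  · exact ok51
  · exact ok52
  · exact ok53
  · exact ok54
  · exact ok55
  · exact ok56
  · exact ok57
  · exact ok58
  · exact ok59
  · exact ok60
  · exact ok61
  · exact ok62
  · exact ok63
  · exact ok64
  · exact ok65
  · exact ok66
  · exact ok67
  · exact ok68
  · exact ok69
  · exact ok70
  · exact ok71
  · exact ok72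
  · exact ok73
  · exact ok74
  · exact ok75
  · exact ok76
  · exact ok77
  · exact ok78
  · exact ok79
  · exact ok80
  · exact ok81
  · exact ok82
  · exact ok83
  · exact ok84
  · exact ok85
  · exact ok86
  · exact ok87

/-! ### The Minkowski bound -/

/-- Every ideal class contains an integral ideal of norm `≤ 269867`. [folklore] -/
theorem hMink (c : ClassGroup (𝓞 K)) :
    ∃ I : nonZeroDivisors (Ideal (𝓞 K)), ClassGroup.mk0 I = c ∧ absNorm (I : Ideal (𝓞 K)) ≤ 269867 := by
  obtain ⟨I, hI, hN⟩ := NumberField.exists_ideal_in_class_of_norm_le c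
  refine ⟨I, hI, ?_⟩
  have h := floor_minkowskiBound_le
  have hN' : (absNorm (I : Ideal (𝓞 K)) : ℝ) ≤ _ := hN
  have : absNorm (I : Ideal (𝓞 K)) ≤ ⌊(4 / Real.pi) ^ InfinitePlace.nrComplexPlaces K *
      ((Module.finrank ℚ K).factorial / (Module.finrank ℚ K : ℝ) ^ Module.finrank ℚ K *
        Real.sqrt |(NumberField.discr K : ℝ)|)⌋₊ := Nat.le_floor hN'
  exact this.trans h

/-! ### Main theorem -/

/-- **The class group of `K` has no `2`-torsion**: an ideal whose square is principal is principal.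
[folklore] -/
theorem isPrincipal_of_sq_isPrincipal {I : Ideal (𝓞 K)} (hI0 : I ≠ ⊥) (hI : (I ^ 2).IsPrincipal) :
    I.IsPrincipal :=
  reads.isPrincipal_of_sq_isPrincipal integerEquiv isSymmetry_shiftInv finrank_K hnorm hnormShift ram11 ram241 hf0 hDex
    (by norm_num : 269867 < 2 ^ 64) chunks hcover hcheck hMink hI0 hI

/-- **The class group has exponent dividing `25`.** [folklore] -/
theorem classGroup_pow_eq_one (c : ClassGroup (𝓞 K)) : c ^ 25 = 1 :=
  reads.classGroup_pow_eq_one integerEquiv isSymmetry_shiftInv finrank_K hnorm hnormShift ram11 ram241 hf0 hDex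
    (by norm_num : 269867 < 2 ^ 64) chunks hcover hcheck hMink c

/-- **The class number of `K` is odd.** [folklore] -/
theorem classNumber_odd : Odd (NumberField.classNumber K) := by
  classical
  rw [Nat.odd_iff, ← Nat.not_even_iff, NumberField.classNumber]
  intro h2
  obtain ⟨c, hc⟩ := exists_prime_orderOf_dvd_card 2 (even_iff_two_dvd.mp h2)
  have h25 := classGroup_pow_eq_one c
  have h1 : c = 1 := by
    have hc2 : c ^ 2 = 1 := by rw [← hc, pow_orderOf_eq_one]
    calc c = c ^ 25 * (c ^ 2)⁻¹ ^ 12 := by group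
      _ = 1 := by rw [h25, hc2]; group
  rw [h1, orderOf_one] at hc
  exact absurd hc (by norm_num)

end CyclicQuintic2651K4

end Literature.NumberTheory.NumberFields

end
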